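import Summits.CriticalPhenomena.CardyFormulaZ2.Theorems.CardyComplexConeSLESixFamiliesGiveCardyCollarDomainsPart9

/-!
# STUB E of line `collar-touch-sandwich`: exterior-collared comparison rectangles (`stub_collarDomains`)

Route `CardyComplexCone`, crux `SLESixFamiliesGiveCardy` (`SLE6Families → CardyFormulaZ2`), line
`collar-touch-sandwich`.  Proof of the registered stub `stub_collarDomains : CollarDomains`: for every
conformal rectangle `R` and `ε > 0`, the upper comparison rectangle `Q₁ = (Ω₁; a⁺, b⁺, c′, d′)` with
`UpperCollarGeom R (Q₁.chord 0 1) (Q₁.arc 2)` and the lower one `Q₂ = (Ω₂; c⁺, d′, a′, b⁺)` with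
`LowerCollarGeom R (Q₂.chord 0 3) (Q₂.arc 1)`, both with smooth exterior marks (`IsSmoothMark`) and
`ε`-close, loop and marks, to `R` (resp. to `R` relabelled `(c, d, a, b)`).  The rectangles are the tube
collars of `Part4`–`Part6` for a collar set-up `S : CollarSetup R ε`; the collar marks are placed by
`exists_smoothMark` (`Part12`) on the plateaus `[m₀ + 1 - 3δ, m₀ + 1 - 2δ]`, `[m₁ + 2δ, m₁ + 3δ]` (upper)
and `[m₂ + 2δ, m₂ + 3δ]`, `[m₁ - 3δ, m₁ - 2δ]` (lower).
-/

noncomputable section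

open Set Metric Topology Filter Complex
open Literature.Probability.RandomPlanarGeometry

namespace Summit.CriticalPhenomena.CardyFormulaZ2.Cruxes.SLESixFamiliesGiveCardy.CollarTouchSandwich

namespace CollarSetup

variable {R : ConformalRectangle} {ε : ℝ} (S : CollarSetup R ε)

/-- `δ / 2 ≤ 1 / 2`. -/
theorem half_δ_le : S.δ / 2 ≤ 1 / 2 := by linarith [S.δ_lt]

/-- **The real plateau of the upper profile behind `a⁺`**: `p = 1 + h` on `(m₀ + 1 - 3δ, m₀ + 1 - 2δ)`. -/
theorem upper_plateau_a (t : ℝ) (ht : |t - (R.mark 0 + 1 - 5 / 2 * S.δ)| < S.δ / 2) : S.upperP.p t = 1 + S.upperP.h := by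
  obtain ⟨hm0, hm01, hm12, hm23, hm30⟩ := R.marks_chain
  have hδ := S.δ_pos; have hg3 := S.gap₃
  obtain ⟨em, ea₁, eb₁, ea₂, eb₂, ed⟩ := S.upperW_eq
  have h := abs_lt.1 ht
  rw [upperP, Windows.profile_h]
  refine S.upperW.profile_eq_of_plateau S.h_pos S.h_le_half (Or.inr ?_)
  rw [S.upperW.rep_of_mem ⟨by rw [em]; linarith, by rw [em]; linarith⟩, ea₂, eb₂, ed]
  constructor <;> linarith

/-- **The real plateau of the upper profile behind `b⁺`**: `p = 1 + h` on `(m₁ + 2δ, m₁ + 3δ)`. -/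
theorem upper_plateau_b (t : ℝ) (ht : |t - (R.mark 1 + 5 / 2 * S.δ)| < S.δ / 2) : S.upperP.p t = 1 + S.upperP.h := by
  obtain ⟨hm0, hm01, hm12, hm23, hm30⟩ := R.marks_chain
  have hδ := S.δ_pos; have hg1 := S.gap₁
  obtain ⟨em, ea₁, eb₁, ea₂, eb₂, ed⟩ := S.upperW_eq
  have h := abs_lt.1 ht
  rw [upperP, Windows.profile_h]
  refine S.upperW.profile_eq_of_plateau S.h_pos S.h_le_half (Or.inl ?_)
  rw [S.upperW.rep_of_mem ⟨by rw [em]; linarith, by rw [em]; linarith⟩, ea₁, eb₁, ed]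
  constructor <;> linarith

/-- **The real plateau of the lower profile behind `c⁺`**: `p = 1 + h` on `(m₂ + 2δ, m₂ + 3δ)`. -/
theorem lower_plateau_c (t : ℝ) (ht : |t - (R.mark 2 + 5 / 2 * S.δ)| < S.δ / 2) : S.lowerP.p t = 1 + S.lowerP.h := by
  obtain ⟨hm0, hm01, hm12, hm23, hm30⟩ := R.marks_chain
  have hδ := S.δ_pos; have hg2 := S.gap₂
  obtain ⟨em, ea₁, eb₁, ea₂, eb₂, ed⟩ := S.lowerW_eq
  have h := abs_lt.1 ht
  rw [lowerP, Windows.profile_h]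
  refine S.lowerW.profile_eq_of_plateau S.h_pos S.h_le_half (Or.inr ?_)
  rw [S.lowerW.rep_of_mem ⟨by rw [em]; linarith, by rw [em]; linarith⟩, ea₂, eb₂, ed]
  constructor <;> linarith

/-- **The real plateau of the lower profile behind `b⁺`**: `p = 1 + h` on `(m₁ - 3δ, m₁ - 2δ)`. -/
theorem lower_plateau_b (t : ℝ) (ht : |t - (R.mark 1 - 5 / 2 * S.δ)| < S.δ / 2) : S.lowerP.p t = 1 + S.lowerP.h := by
  obtain ⟨hm0, hm01, hm12, hm23, hm30⟩ := R.marks_chain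
  have hδ := S.δ_pos; have hg0 := S.gap₀
  obtain ⟨em, ea₁, eb₁, ea₂, eb₂, ed⟩ := S.lowerW_eq
  have h := abs_lt.1 ht
  rw [lowerP, Windows.profile_h]
  refine S.lowerW.profile_eq_of_plateau S.h_pos S.h_le_half (Or.inl ?_)
  rw [S.lowerW.rep_of_mem ⟨by rw [em]; linarith, by rw [em]; linarith⟩, ea₁, eb₁, ed]
  constructor <;> linarith

include S in
/-- **The upper half of STUB E.** -/
theorem upper_exists : ∃ (Q : ConformalRectangle) (c : ℝ), UpperCollarGeom R (Q.chord 0 1 (by decide)) (Q.arc 2) ∧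
    IsSmoothMark (Q.chord 0 1 (by decide)) 0 ∧ IsSmoothMark (Q.chord 0 1 (by decide)) 1 ∧
    (∀ s : ℝ, dist (Q.boundary s) (R.boundary (s + c)) ≤ ε) ∧ ∀ i : Fin 4, |Q.mark i + c - R.mark i| ≤ ε := by
  have hδ := S.δ_pos
  have hcl := S.hclose S.upperP rfl
  have hP4 : S.upperP.h ≤ 1 / 4 := S.h_le
  obtain ⟨t_a, hta0, ea, ga, ra, hea, hra, hgac, hga0, hgad, hiffa⟩ :=
    exists_smoothMark S.T S.upperP hcl hP4 (half_pos hδ) S.half_δ_le S.upper_plateau_a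
  obtain ⟨t_b, htb0, eb, gb, rb, heb, hrb, hgbc, hgb0, hgbd, hiffb⟩ :=
    exists_smoothMark S.T S.upperP hcl hP4 (half_pos hδ) S.half_δ_le S.upper_plateau_b
  have hta : t_a ∈ Icc (R.mark 0 + 1 - 3 * S.δ) (R.mark 0 + 1 - 2 * S.δ) := by
    have := abs_lt.1 hta0; constructor <;> linarith
  have htb : t_b ∈ Icc (R.mark 1 + 2 * S.δ) (R.mark 1 + 3 * S.δ) := by
    have := abs_lt.1 htb0; constructor <;> linarith
  obtain ⟨-, -, -, hp0, hp1⟩ := S.upper_arcs hta htb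
  have hp0' : ((S.upperRect hta htb).chord 0 1 (by decide)).pt 0 = profileLoop S.T S.upperP.p t_a := by
    rw [hp0, ← sub_add_cancel t_a 1, periodic_profileLoop S.T S.upperP (t_a - 1), sub_add_cancel]
  refine ⟨S.upperRect hta htb, t_a - 1, S.upperCollarGeom hta htb, ?_, ?_, (S.upper_close hta htb).1, (S.upper_close hta htb).2⟩
  · exact ⟨ea, ga, ra, hea, hra, hgac, hga0, hgad, fun w hw => by rw [hp0']; exact hiffa w hw⟩
  · exact ⟨eb, gb, rb, heb, hrb, hgbc, hgb0, hgbd, fun w hw => by rw [hp1]; exact hiffb w hw⟩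

include S in
/-- **The lower half of STUB E.** -/
theorem lower_exists : ∃ (Q : ConformalRectangle) (c : ℝ), LowerCollarGeom R (Q.chord 0 3 (by decide)) (Q.arc 1) ∧
    IsSmoothMark (Q.chord 0 3 (by decide)) 0 ∧ IsSmoothMark (Q.chord 0 3 (by decide)) 1 ∧
    (∀ s : ℝ, dist (Q.boundary s) (R.boundary (s + c)) ≤ ε) ∧
    |Q.mark 0 + c - R.mark 2| ≤ ε ∧ |Q.mark 1 + c - R.mark 3| ≤ ε ∧
    |Q.mark 2 + c - (R.mark 0 + 1)| ≤ ε ∧ |Q.mark 3 + c - (R.mark 1 + 1)| ≤ ε := by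
  have hδ := S.δ_pos
  have hcl := S.hclose S.lowerP rfl
  have hP4 : S.lowerP.h ≤ 1 / 4 := S.h_le
  obtain ⟨t_c, htc0, ec, gc, rc, hec, hrc, hgcc, hgc0, hgcd, hiffc⟩ :=
    exists_smoothMark S.T S.lowerP hcl hP4 (half_pos hδ) S.half_δ_le S.lower_plateau_c
  obtain ⟨t_b, htb0, eb, gb, rb, heb, hrb, hgbc, hgb0, hgbd, hiffb⟩ :=
    exists_smoothMark S.T S.lowerP hcl hP4 (half_pos hδ) S.half_δ_le S.lower_plateau_b
  have htc : t_c ∈ Icc (R.mark 2 + 2 * S.δ) (R.mark 2 + 3 * S.δ) := by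
    have := abs_lt.1 htc0; constructor <;> linarith
  have htb : t_b ∈ Icc (R.mark 1 - 3 * S.δ) (R.mark 1 - 2 * S.δ) := by
    have := abs_lt.1 htb0; constructor <;> linarith
  obtain ⟨-, -, hp0, hp1⟩ := S.lower_arcs htc htb
  have hp1' : ((S.lowerRect htc htb).chord 0 3 (by decide)).pt 1 = profileLoop S.T S.lowerP.p t_b := by
    rw [hp1, periodic_profileLoop S.T S.lowerP t_b]
  obtain ⟨hcl1, hcl2, hcl3, hcl4, hcl5⟩ := S.lower_close htc htb
  refine ⟨S.lowerRect htc htb, t_c, S.lowerCollarGeom htc htb, ?_, ?_, hcl1, hcl2, hcl3, hcl4, hcl5⟩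
  · exact ⟨ec, gc, rc, hec, hrc, hgcc, hgc0, hgcd, fun w hw => by rw [hp0]; exact hiffc w hw⟩
  · exact ⟨eb, gb, rb, heb, hrb, hgbc, hgb0, hgbd, fun w hw => by rw [hp1']; exact hiffb w hw⟩

end CollarSetup

/-- **STUB E of the line `collar-touch-sandwich`** (registered stub `stub_collarDomains`):
exterior-collared comparison rectangles with smooth exterior marks, uniformly close to `R`. -/
theorem stub_collarDomains : CollarDomains := by
  intro R ε hε
  obtain ⟨S⟩ := exists_collarSetup R hε
  exact ⟨S.upper_exists, S.lower_exists⟩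

end Summit.CriticalPhenomena.CardyFormulaZ2.Cruxes.SLESixFamiliesGiveCardy.CollarTouchSandwich

end
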